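import Literature.MathematicalPhysics.QuantumFieldTheory.OSWightmanVectors
import Literature.MathematicalPhysics.QuantumFieldTheory.OSWightmanFamilyAssembly
import Literature.MathematicalPhysics.QuantumFieldTheory.OSTimeContinuationProofs
import HarnessLib

/-!
# (A₃) `OS1973_isWightmanFamily_of_continuation` from the analytic continuation of OS II

Topic `Literature/MathematicalPhysics/QuantumFieldTheory`; assembly file for the named fact
`Literature.MathematicalPhysics.QuantumFieldTheory.OS1973_isWightmanFamily_of_continuation`
((A₃) of `WightmanProofs`: the boundary values of an OS continuation family have the Wightman
properties (a)–(f) and `𝒲₀ = 1`; Osterwalder–Schrader I (1973), §4.1 (end)–§4.5, OS II (1975),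
§IV.2 p. 288: "The remaining Wightman axioms can be established as in Sections 4.2–4.5 of OS I").

Every conjunct of (A₃) is now a theorem of the tree *given the analytic continuation with
half-space support* (A₁₂⁺) `OS1975_exists_continuation_halfSpace` (OS II, Thms. 4.1–4.3), which
pins down the continuation family by uniqueness (`IsOSContinuationFamily.unique`):

* (a) Poincaré invariance — `OS1973_lorentzInvariant_holds` and the translation invariance of
  `WightmanProofs` (OS I §4.2, from E1);
* (b) spectral condition — `OS1973_spectralCondition_of_halfSpace` (`WightmanProofs`; OS I p. 93,
  half-space support upgraded by Lorentz invariance, `LorentzSpectralSupport`);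
* (c) hermiticity — `OS1973_hermitian_holds` (`WightmanProofs`; E1, E2);
* (d) locality — `OS1973_local_of_halfSpace` (`OSLocalityHolds`; OS I §4.5: E3, the
  Bargmann–Hall–Wightman theorem and the Fourier–Laplace edge growth, both discharged);
* (e) positivity — `OS1973_positiveDefinite_of_halfSpace` (`OSWightmanVectors`; OS I §4.3 (4.28),
  the Wightman vectors, with Lemma 4.1 = `OSLaplaceDensity`);
* (f) cluster property — `OS1973_cluster_of_halfSpace` (`OSWightmanVectors` through
  `OS1973_cluster_of_vectors`/`WightmanClusterVectors` and `WightmanClusterLorentz`; OS I §4.4 (4.30));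
* `𝒲₀ = 1` — `IsOSContinuationFamily.isNormalisedFamily` (`WightmanProofs`).

Results:

* `OS1973_isWightmanFamily_of_continuation_of_halfSpace' : (A₁₂⁺) → (A₃)` (the three-hypothesis
  form `…_of_halfSpace : (A₁₂⁺) → (e) → (f) → (A₃)` of `OSWightmanFamilyAssembly` with (e), (f) now
  supplied by `OSWightmanVectors`);
* `OS1975_exists_wightmanFamily_of_halfSpace' : (A₁₂⁺) → (A)` (the parent fact
  `OS1975_exists_wightmanFamily`, OS II Thm. E'→R' on the level of vacuum expectation values);
* with (A2) and (D) of `OSTimeContinuation` discharged (`OSTimeContinuationProofs`,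
  `OSTimeTubeUniqueness`), the same from the two remaining named facts of OS II's own route —
  (A1) `OS1975_exists_timeContinuation` (OS II Thm. 4.3: the time continuation with the
  temperedness estimate (4.6)) and (B) `OS1973_lorentzInvariant_of_timeContinuation` (OS I §4.2 for
  the time continuation): `OS1973_isWightmanFamily_of_continuation_of_A1_B`,
  `OS1975_exists_wightmanFamily_of_A1_B`, `os_reconstruction_of_A1_B'`.

## References

* K. Osterwalder, R. Schrader, *Axioms for Euclidean Green's functions*, Comm. Math. Phys. 31
  (1973) 83–112, §4.1 p. 93, §§4.2–4.5. [OsterwalderSchraderCMP1973]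
* K. Osterwalder, R. Schrader, *Axioms for Euclidean Green's functions II*, Comm. Math. Phys. 42
  (1975) 281–305, §IV.1 Theorem E'→R', §IV.2 p. 288, Thms. 4.1–4.3. [OsterwalderSchraderCMP1975]
-/

namespace Literature.MathematicalPhysics.QuantumFieldTheory

/-- **(A₃) from (A₁₂⁺).** For an OS family with E0' and any OS continuation family `𝒲` of it, `𝒲`
has the Wightman properties (a)–(f) and `𝒲₀ = 1` — granted the analytic continuation with
half-space support of Osterwalder–Schrader II (`OS1975_exists_continuation_halfSpace`), from which
(b) and (d)–(f) are derived for the unique continuation family; (a), (c) and the normalisation hold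
unconditionally. Real proof (`OS1973_isWightmanFamily_of_continuation_of_halfSpace` of
`OSWightmanFamilyAssembly` with (e), (f) from `OSWightmanVectors`). [cite: OsterwalderSchraderCMP1973, §4.1 (p. 93, R0 and R5) and §§4.2–4.5 (R1–R4)] [cite: OsterwalderSchraderCMP1975, §IV.2 p. 288] -/
theorem OS1973_isWightmanFamily_of_continuation_of_halfSpace'
    (hA : OS1975_exists_continuation_halfSpace) : OS1973_isWightmanFamily_of_continuation :=
  OS1973_isWightmanFamily_of_continuation_of_halfSpace hA (OS1973_positiveDefinite_of_halfSpace hA)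
    (OS1973_cluster_of_halfSpace hA)

/-- **(A) `OS1975_exists_wightmanFamily` from (A₁₂⁺)**: the Wightman distributions of an OS family
with E0' exist (Osterwalder–Schrader II, Theorem E'→R' on the level of vacuum expectation values),
granted the analytic continuation with half-space support. Real proof. [cite: OsterwalderSchraderCMP1975, §IV.1 Thm. E'→R' (p. 287) and §IV.2 Thms. 4.1–4.3, (4.7)] -/
theorem OS1975_exists_wightmanFamily_of_halfSpace' (hA : OS1975_exists_continuation_halfSpace) :
    OS1975_exists_wightmanFamily :=
  OS1975_exists_wightmanFamily_of_halfSpace hA (OS1973_positiveDefinite_of_halfSpace hA)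
    (OS1973_cluster_of_halfSpace hA)

/-- **(A₃) from OS II's time continuation (A1) and its Lorentz invariance (B)** — (A2), (D) being
theorems (`OS1975_exists_continuation_halfSpace_of_A1_B`). Real proof. [cite: OsterwalderSchraderCMP1975, §IV.2 pp. 288–289] -/
theorem OS1973_isWightmanFamily_of_continuation_of_A1_B
    (hA1 : OS1975_exists_timeContinuation) (hB : OS1973_lorentzInvariant_of_timeContinuation) :
    OS1973_isWightmanFamily_of_continuation :=
  OS1973_isWightmanFamily_of_continuation_of_halfSpace' (OS1975_exists_continuation_halfSpace_of_A1_B hA1 hB)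

/-- **(A) from (A1) and (B).** Real proof. [cite: OsterwalderSchraderCMP1975, §IV.2 pp. 288–289] -/
theorem OS1975_exists_wightmanFamily_of_A1_B
    (hA1 : OS1975_exists_timeContinuation) (hB : OS1973_lorentzInvariant_of_timeContinuation) :
    OS1975_exists_wightmanFamily :=
  OS1975_exists_wightmanFamily_of_halfSpace' (OS1975_exists_continuation_halfSpace_of_A1_B hA1 hB)

/-- **`os_reconstruction` from (A1) and (B) alone**: every other ingredient of
Osterwalder–Schrader's E'→R' (temperedness of the boundary values (A2), uniqueness on the time tube
(D), R1–R5, hermiticity, the Wightman reconstruction theorem and uniqueness of the reconstructed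
theory) is a theorem of the tree. Real proof (`os_reconstruction_of_exists_continuation_halfSpace`).
[cite: OsterwalderSchraderCMP1975, §IV.1 Thm. E'→R'] -/
theorem os_reconstruction_of_A1_B'
    (hA1 : OS1975_exists_timeContinuation) (hB : OS1973_lorentzInvariant_of_timeContinuation) :
    os_reconstruction :=
  os_reconstruction_of_exists_continuation_halfSpace (OS1975_exists_continuation_halfSpace_of_A1_B hA1 hB)

end Literature.MathematicalPhysics.QuantumFieldTheory
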